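import Summits.FinalStateConjecture.FinalStateConjecture.Theses.PhotonSphereChannels

/-!
# CensusS7 — strategist s7 (second INDEPENDENT strategy census, family `s`) for the crux
`ChannelsResolveTameDevelopmentsR` (item stmt-FinalStateConjecture-17430, route `PhotonSphereChannels`)

Lean companion of `STRATEGY-CENSUS-s7.md`, heading **Weaker intermediate**. It certifies the glue
algebra the census argues from (nothing here is deep; the point is that it is *checked*):

* `SummitPointwise X D` — the summit's pointwise final-state property `P` of one admissible datum,
  verbatim from `FinalStateConjecture`; `RouteQ X D` — the route's bundled tame property `Q` (the property
  K3 = `TameCensorship` makes tame-generic; its second conjunct is exactly the hypotheses of K2R).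
  `finalStateConjecture_iff`, `tameCensorship_iff` : both identifications hold by `Iff.rfl`.
* `IsTameChristodoulouGeneric.mono'` — tame Christodoulou genericity is MONOTONE in the property (the
  `mono` step of the route's `closes`, for every codimension `m`).
* `reglue` — THE GENERAL GLUE: for ANY per-topology property `Q'`, pointwise `Q' → P` on admissible data
  together with `TameGeneric Q' 1` closes the summit. Every admissible replacement of K2R by a weaker
  pointwise statement `Q⁺ → P` (hypothesis strengthened to `Q⁺`) is paid for by `K3 ↦ TameGeneric Q⁺`.
* `PointwiseResolution` — the per-DATUM form `∀ Σ D, Q D → P D`; `pointwiseResolution_of_k2R` (K2R ⇒ it,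
  using the landed K1R) and `closes_of_pointwiseResolution` (it ∧ K3 ⇒ summit). So the per-datum form is a
  formally weaker intermediate that glues verbatim — but it differs from K2R only by MGHD-uniqueness
  bookkeeping (K2R quantifies per maximal development), i.e. it removes none of the analysis.

No `sorry`. Imports only the route file.
-/

set_option linter.dupNamespace false
set_option autoImplicit false

namespace Summit.FinalStateConjecture.FinalStateConjecture.Cruxes.ChannelsResolveTameDevelopmentsR.CensusS7

open Summit.FinalStateConjecture.FinalStateConjecture.Theses.PhotonSphereChannels
open Literature.Geometry.Lorentzian
open scoped Manifold ContDiff Topology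

/-- The summit's pointwise final-state property `P` of an admissible datum (verbatim from
`FinalStateConjecture`). [folklore] -/
def SummitPointwise (X : Type) [TopologicalSpace X] [ChartedSpace E3 X] [IsManifold (𝓡 3) ∞ X] [T2Space X]
    [SecondCountableTopology X] [ConnectedSpace X] (D : InitialDataSet (𝓡 3) X) : Prop :=
  (∃ 𝒟 : VacuumCauchyDevelopment D, 𝒟.IsMaximal) ∧
    ∀ 𝒟 : VacuumCauchyDevelopment D, 𝒟.IsMaximal →
      Summit.FinalStateConjecture.HasCompleteNullInfinity 𝒟.toCauchyDevelopment ∧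
        ∃ (O : Set 𝒟.carrier) (d : FinalStateDecomposition 𝒟.toSpacetime O 2),
          (∀ i, Kerr.IsSubextremal (d.mass i) (d.spin i)) ∧
            O = Summit.FinalStateConjecture.exteriorOf 𝒟.toCauchyDevelopment d.charted ∧
              Summit.FinalStateConjecture.RaysStayInClosure 𝒟.toCauchyDevelopment O ∧
                Summit.FinalStateConjecture.HasExhaustiveCharts d ∧
                  Summit.FinalStateConjecture.IsFutureOriented d

/-- The summit is `∀ Σ, TameGeneric P 1` with `P = SummitPointwise Σ`. [folklore] -/
theorem finalStateConjecture_iff :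
    _root_.FinalStateConjecture ↔
      ∀ (X : Type) [TopologicalSpace X] [ChartedSpace E3 X] [IsManifold (𝓡 3) ∞ X] [T2Space X]
        [SecondCountableTopology X] [ConnectedSpace X],
        InitialDataSet.IsTameChristodoulouGeneric (admissibleVacuumData X) (SummitPointwise X) 1 :=
  Iff.rfl

/-- The hypotheses (i) no extremal remnant ∧ (ii) tame outer region of K2R, for one development
(verbatim sub-formula of `ChannelsResolveTameDevelopmentsR` / `TameCensorship`). [folklore] -/
def TameHyp {X : Type} [TopologicalSpace X] [ChartedSpace E3 X] [IsManifold (𝓡 3) ∞ X] [T2Space X]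
    [SecondCountableTopology X] [ConnectedSpace X] {D : InitialDataSet (𝓡 3) X}
    (𝒟 : VacuumCauchyDevelopment D) : Prop :=
  (∀ (Λ : lorentzGroup) (c : E4) (M a : ℝ), Kerr.IsExtremal M a → ¬ ∃ (τ₀ : ℝ) (Ψ : (boostedKerrBackground Λ c M a).domain → 𝒟.carrier), 𝒟.toSpacetime.IsLateChart (boostedKerrBackground Λ c M a) Set.univ τ₀ Ψ ∧ ∀ R : ℝ, Filter.Tendsto (fun τ => 𝒟.toSpacetime.truncDeviationCk (boostedKerrBackground Λ c M a) Ψ 2 R τ) Filter.atTop (nhds 0)) ∧ ∀ [𝒟.metric.HasLeviCivita], let outer : Set 𝒟.carrier := 𝒟.metric.causalFuture 𝒟.timeOrientation (Set.range 𝒟.embed) ∩ {q | ∃ (p : X) (γ : ℝ → 𝒟.carrier) (dom : Set ℝ), 𝒟.metric.IsNormalisedNullRayFrom 𝒟.timeOrientation 𝒟.embed 𝒟.normal p γ dom ∧ ¬ BddAbove dom ∧ q ∈ 𝒟.metric.chronologicalPast 𝒟.timeOrientation (γ '' (dom ∩ Set.Ici 0))}; ∃ r₀ : ℝ, 0 <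 r₀ ∧ ∃ Λ : NNReal, ∀ q ∈ outer, let U : TopologicalSpace.Opens E4 := ⟨Metric.ball (0 : E4) r₀, Metric.isOpen_ball⟩; ∃ Ψ : U → 𝒟.carrier, 𝒟.toSpacetime.IsLateChart (Minkowski.backgroundOn U) Set.univ (-r₀) Ψ ∧ (∃ x : U, (x : E4) = 0 ∧ Ψ x = q) ∧ supCkENorm (U : Set E4) 3 (𝒟.toSpacetime.deviationExtend (Minkowski.backgroundOn U) Ψ) ≤ (Λ : ENNReal) ∧ supCkENorm (U : Set E4) 0 (𝒟.toSpacetime.deviationExtend (Minkowski.backgroundOn U) Ψ) ≤ 1 / 2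

/-- The route's bundled tame property `Q` of a datum (the property K3 makes tame-generic). [folklore] -/
def RouteQ (X : Type) [TopologicalSpace X] [ChartedSpace E3 X] [IsManifold (𝓡 3) ∞ X] [T2Space X]
    [SecondCountableTopology X] [ConnectedSpace X] (D : InitialDataSet (𝓡 3) X) : Prop :=
  (∃ 𝒟 : VacuumCauchyDevelopment D, 𝒟.IsMaximal) ∧
    ∀ 𝒟 : VacuumCauchyDevelopment D, 𝒟.IsMaximal →
      Summit.FinalStateConjecture.HasCompleteNullInfinity 𝒟.toCauchyDevelopment ∧ TameHyp 𝒟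

/-- K3 is `∀ Σ, TameGeneric Q 1` with `Q = RouteQ Σ`. [folklore] -/
theorem tameCensorship_iff :
    TameCensorship ↔
      ∀ (X : Type) [TopologicalSpace X] [ChartedSpace E3 X] [IsManifold (𝓡 3) ∞ X] [T2Space X]
        [SecondCountableTopology X] [ConnectedSpace X],
        InitialDataSet.IsTameChristodoulouGeneric (admissibleVacuumData X) (RouteQ X) 1 :=
  Iff.rfl

/-- **Tame Christodoulou genericity is monotone in the property** (every codimension): the witnessing
end, family, tameness and immersion are kept, only exceptional-set membership is transported.
(The `mono` step of the route's `closes`.) [folklore] -/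
theorem IsTameChristodoulouGeneric.mono' {X : Type} [TopologicalSpace X] [ChartedSpace E3 X]
    [IsManifold (𝓡 3) ∞ X] {𝓓 : Set (InitialDataSet (𝓡 3) X)} {P Q : InitialDataSet (𝓡 3) X → Prop} {m : ℕ}
    (hQP : ∀ D ∈ 𝓓, Q D → P D) (hQ : InitialDataSet.IsTameChristodoulouGeneric 𝓓 Q m) :
    InitialDataSet.IsTameChristodoulouGeneric 𝓓 P m := by
  intro D hD
  obtain ⟨e, F, hF, himm, h0, hinj, hadm, hexc⟩ := hQ D ⟨hD.1, fun h => hD.2 (hQP D hD.1 h)⟩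
  exact ⟨e, F, hF, himm, h0, hinj, hadm, fun c hc hmem => hexc c hc ⟨hmem.1, fun h => hmem.2 (hQP _ hmem.1 h)⟩⟩

/-- **The general glue.** For ANY per-topology property `Q'` of data: pointwise `Q' → P` on admissible data
plus tame genericity of `Q'` closes the summit. The route's `closes` is the instance `Q' = RouteQ`. Any
"weaker K2R" of the form `Q⁺ → P` with `Q⁺` strictly stronger than `Q` re-glues only through this lemma,
i.e. at the price `K3 ↦ TameGeneric Q⁺`. [folklore] -/
theorem reglue
    (h : ∀ (X : Type) [TopologicalSpace X] [ChartedSpace E3 X] [IsManifold (𝓡 3) ∞ X] [T2Space X]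
      [SecondCountableTopology X] [ConnectedSpace X],
      ∃ Q' : InitialDataSet (𝓡 3) X → Prop,
        (∀ D ∈ admissibleVacuumData X, Q' D → SummitPointwise X D) ∧
          InitialDataSet.IsTameChristodoulouGeneric (admissibleVacuumData X) Q' 1) :
    _root_.FinalStateConjecture := by
  intro X i₁ i₂ i₃ i₄ i₅ i₆
  obtain ⟨Q', hQP, hQ⟩ := h X
  exact IsTameChristodoulouGeneric.mono' hQP hQ

/-- **Per-datum tame resolution** — the formally weakest statement that glues with K3 AS FILED:
on every admissible datum, `Q D → P D`. [folklore] -/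
def PointwiseResolution : Prop :=
  ∀ (X : Type) [TopologicalSpace X] [ChartedSpace E3 X] [IsManifold (𝓡 3) ∞ X] [T2Space X]
    [SecondCountableTopology X] [ConnectedSpace X],
    ∀ D ∈ admissibleVacuumData X, RouteQ X D → SummitPointwise X D

/-- Per-datum resolution and K3 close the summit (instance `Q' = RouteQ` of `reglue`). [folklore] -/
theorem closes_of_pointwiseResolution (h₂ : PointwiseResolution) (h₃ : TameCensorship) :
    _root_.FinalStateConjecture :=
  reglue fun X _ _ _ _ _ _ => ⟨RouteQ X, h₂ X, h₃ X⟩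

/-- **K2R ⇒ per-datum resolution** (with K1R = `UniformPhotonSphereChannelsR_holds` a theorem of the
tree): the pointwise half of the route's `closes`, sub-extremality of every hole re-derived from
`|aᵢ| ≤ Mᵢ` and clause (i). [folklore] -/
theorem pointwiseResolution_of_k2R (h₂ : ChannelsResolveTameDevelopmentsR) : PointwiseResolution := by
  intro X i₁ i₂ i₃ i₄ i₅ i₆ D hD hQ
  obtain ⟨hex, hQ⟩ := hQ
  refine ⟨hex, fun 𝒟 hmax => ?_⟩
  obtain ⟨hcomp, htame⟩ := hQ 𝒟 hmax
  obtain ⟨O, d, hO, hrays, hexh, hfo⟩ := h₂ UniformPhotonSphereChannelsR_holds X D hD 𝒟 hmax hcomp htame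
  refine ⟨hcomp, O, d, fun i => ?_, hO, hrays, hexh, hfo⟩
  rcases lt_or_eq_of_le (d.abs_spin_le_mass i) with hlt | heq
  · exact hlt
  · exact absurd ⟨d.τ₀, d.chart i, ⟨(d.isLateChart i).contMDiff, (d.isLateChart i).isOpenEmbedding,
        Set.subset_univ _⟩, d.tendsto_truncDeviationCk i⟩
      (htame.1 (d.motion i).1 (d.motion i).2 (d.mass i) (d.spin i) ⟨heq, d.mass_pos i⟩)

/-- Sanity: the route's deciding theorem factors through the per-datum form. [folklore] -/
theorem closes_factors (h₂ : ChannelsResolveTameDevelopmentsR) (h₃ : TameCensorship) :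
    _root_.FinalStateConjecture :=
  closes_of_pointwiseResolution (pointwiseResolution_of_k2R h₂) h₃

end Summit.FinalStateConjecture.FinalStateConjecture.Cruxes.ChannelsResolveTameDevelopmentsR.CensusS7
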